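import Summits.PneNP.PneNP.Theses.PhaseTwins
import Literature.Computability.Complexity.HardcoreInapproximability
import Literature.Computability.Complexity.KarpCliqueGadget

/-!
# Route PhaseTwins, crux `PseudorandomTwinsAbove` (stmt-PneNP-2721) — negative side: tightness of the picked line's targets (I)

Disprover's cycle 3 (work file `Summits/PneNP/PneNP/Cruxes/PseudorandomTwinsAbove/Disproof.lean`).
The lead's picked line `Lines/prg-image-exact-threshold-lift.lean` (`OWFExist → PseudorandomTwinsAbove`)
has six stubs; all survive the cheap arsenal (drefute r1 and this seat agree). Side conditions of
two of them are shown LOAD-BEARING, by kernel-checked refutations of the weakened stubs (this file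
and `TargetsOccurrence.lean`):

* `not_conflictGraphGapWithoutNodup` — stub S4b (`stub_conflictGraphGap`, the counting window on
  conflict graphs) becomes FALSE when `φ.IsExactWidth 3` is weakened to "clauses of length 3"
  (variables may repeat inside a clause): equal literals of one clause are compatible in the
  conflict graph, so `α = m · val(φ)` fails. Witness `φno = (x∨x∨x) ∧ (¬x∨¬x∨¬x)` (`val = 1/2`,
  conflict graph `K₃,₃`, `N ≥ q⁶ + 6pq⁵ + 2p²q⁴`) against the satisfiable
  `φyes = (x₀∨x₁∨x₂) ∧ (x₃∨x₄∨x₅)` (`2K₃`, `N ≤ q⁶ + 6pq⁵ + 15p²q⁴`): `8·N(no) > N(yes)` for every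
  `(Δ, p, q)` with `q ≥ 1`, so no threshold `τ 2` exists. Hence the E3 rendering that feeds S4b
  must keep three distinct variables per clause (the tree's `GapMachine.spec` does).
* `not_dupPadWithPlainBound` — stub S2b (`stub_dupPad`) with the output occurrence bound `B`
  instead of `max B 1` is FALSE (empty input CNF, `B = 0`, but `m |y| > 0` padding clauses).
* Harmless corners: `maxSatFraction_nil_le_iff` (S2b at `φ = []` is vacuous BECAUSE the tree sets
  `val [] = 1`), `hardcoreCount_conflictGraph_nil` (S4b's `0 < φ.length` is removable: the empty
  conflict graph has `N = 1`, forcing only `τ 0 = 0`).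

Generic counting lemmas for conflict-graph codes (`sum_indep_le_of_no_triple`,
`le_sum_indep_of_two_pairs`, `maxDegree_le_of_card_filter_le`) are stated with the classical
`if`/instance of `hardcoreCount` so that they rewrite under `hardcoreCount_encode_of_maxDegree_le`.
-/

set_option linter.dupNamespace false -- `Summit.PneNP.PneNP.…`: summit = sub-problem (D-0017)

namespace Summit.PneNP.PneNP.Theorems.PseudorandomTwinsAbove.Negative

open Literature.Computability.Complexity Literature.Probability.LatticeModels
open Finset

/-! ## The conflict graph of the line (verbatim the `fromRel` term of stubs S4a/S4b) -/

/-- The CONFLICT GRAPH on the annotated literal occurrences `KarpClique.annot 0 φ` (clause number,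
variable numeral, polarity): occurrences are adjacent iff they lie in the same clause on
different variables, or carry the same variable with opposite polarities — verbatim the
`SimpleGraph.fromRel` term of the lead's stubs `stub_conflictGraphFn` / `stub_conflictGraphGap`.
[folklore] -/
abbrev conflictGraph (φ : CNF ℕ) : SimpleGraph (Fin (KarpClique.annot 0 φ).length) :=
  SimpleGraph.fromRel fun p q : Fin (KarpClique.annot 0 φ).length =>
    ((KarpClique.annot 0 φ)[p].1 = (KarpClique.annot 0 φ)[q].1 ∧
        (KarpClique.annot 0 φ)[p].2.1 ≠ (KarpClique.annot 0 φ)[q].2.1) ∨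
    ((KarpClique.annot 0 φ)[p].2.1 = (KarpClique.annot 0 φ)[q].2.1 ∧
        (KarpClique.annot 0 φ)[p].2.2 ≠ (KarpClique.annot 0 φ)[q].2.2)

/-! ## Generic counting lemmas (classical `if`, as in `hardcoreCount`) -/

/-- `maxDegree` through a computable degree bound, for an ARBITRARY decidability instance (the
counting function `hardcoreCount` states its promise with the classical one). [folklore] -/
theorem maxDegree_le_of_card_filter_le {n : ℕ} (G : SimpleGraph (Fin n)) [d : DecidableRel G.Adj]
    (k : ℕ) (h : ∀ v, (univ.filter fun w => G.Adj v w).card ≤ k) (inst : DecidableRel G.Adj) :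
    @SimpleGraph.maxDegree _ G _ inst ≤ k := by
  have hi : inst = d := Subsingleton.elim _ _
  subst hi
  refine SimpleGraph.maxDegree_le_of_forall_degree_le G k fun v => ?_
  rw [← SimpleGraph.card_neighborFinset_eq_degree]
  refine (card_le_card fun w hw => ?_).trans (h v)
  rw [SimpleGraph.mem_neighborFinset] at hw
  exact mem_filter.2 ⟨mem_univ _, hw⟩

open scoped Classical in
/-- If no `3`-set is independent, the hard-core sum is at most the weight of ALL sets of size
`≤ 2`: `Σ_{k ≤ 2} C(n,k) p^k q^{n-k}`. [folklore] -/
theorem sum_indep_le_of_no_triple {n : ℕ} (G : SimpleGraph (Fin n)) (p q : ℕ)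
    (hG : ∀ I : Finset (Fin n), 3 ≤ I.card → ¬ G.IsIndepSet (↑I : Set (Fin n)))
    (m : ℕ) (hm : n = m) :
    ∑ I : Finset (Fin n), (if G.IsIndepSet (↑I : Set (Fin n)) then p ^ I.card * q ^ (n - I.card) else 0)
      ≤ ∑ k ∈ range (m + 1), m.choose k * (if k ≤ 2 then p ^ k * q ^ (m - k) else 0) := by
  subst hm
  calc ∑ I : Finset (Fin n),
        (if G.IsIndepSet (↑I : Set (Fin n)) then p ^ I.card * q ^ (n - I.card) else 0)
      ≤ ∑ I : Finset (Fin n), (if I.card ≤ 2 then p ^ I.card * q ^ (n - I.card) else 0) := by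
        refine sum_le_sum fun I _ => ?_
        by_cases hc : I.card ≤ 2
        · rw [if_pos hc]
          split_ifs
          · exact le_rfl
          · exact Nat.zero_le _
        · rw [if_neg hc, if_neg (hG I (by omega))]
    _ = ∑ k ∈ range (n + 1), n.choose k * (if k ≤ 2 then p ^ k * q ^ (n - k) else 0) := by
        have h := Finset.sum_powerset_apply_card
          (fun k => if k ≤ 2 then p ^ k * q ^ (n - k) else 0) (x := (univ : Finset (Fin n)))
        rw [Finset.powerset_univ, card_univ, Fintype.card_fin] at h
        rw [h]
        simp only [smul_eq_mul]

open scoped Classical in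
/-- `∅`, the `n` singletons and two distinct independent pairs already give
`q^n + n·p·q^{n-1} + 2·p²·q^{n-2}`. [folklore] -/
theorem le_sum_indep_of_two_pairs {n : ℕ} (G : SimpleGraph (Fin n)) (p q : ℕ) (L R : Finset (Fin n))
    (hL : G.IsIndepSet (↑L : Set (Fin n))) (hR : G.IsIndepSet (↑R : Set (Fin n)))
    (hLc : L.card = 2) (hRc : R.card = 2) (hLR : L ≠ R) (m : ℕ) (hm : n = m) :
    q ^ m + m * (p * q ^ (m - 1)) + 2 * (p ^ 2 * q ^ (m - 2)) ≤
      ∑ I : Finset (Fin n),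
        (if G.IsIndepSet (↑I : Set (Fin n)) then p ^ I.card * q ^ (n - I.card) else 0) := by
  subst hm
  let S : Finset (Finset (Fin n)) :=
    univ.map ⟨fun v : Fin n => ({v} : Finset (Fin n)), Finset.singleton_injective⟩
  let T : Finset (Finset (Fin n)) := insert ∅ (insert L (insert R S))
  have hS : ∀ A ∈ S, A.card = 1 := by
    intro A hA
    obtain ⟨v, -, rfl⟩ := mem_map.1 hA
    rfl
  have hempty : (∅ : Finset (Fin n)) ∉ insert L (insert R S) := by
    simp only [mem_insert, not_or]
    refine ⟨fun h => ?_, fun h => ?_, fun h => ?_⟩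
    · have := congrArg Finset.card h; rw [hLc] at this; simp at this
    · have := congrArg Finset.card h; rw [hRc] at this; simp at this
    · have := hS _ h; simp at this
  have hLm : L ∉ insert R S := by
    simp only [mem_insert, not_or]
    refine ⟨hLR, fun h => ?_⟩
    have := hS _ h; omega
  have hRm : R ∉ S := fun h => by have := hS _ h; omega
  calc q ^ n + n * (p * q ^ (n - 1)) + 2 * (p ^ 2 * q ^ (n - 2))
      = ∑ I ∈ T, (if G.IsIndepSet (↑I : Set (Fin n)) then p ^ I.card * q ^ (n - I.card) else 0) := by
        rw [sum_insert hempty, sum_insert hLm, sum_insert hRm, sum_map]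
        have e1 : (if G.IsIndepSet (↑(∅ : Finset (Fin n)) : Set (Fin n)) then
            p ^ (∅ : Finset (Fin n)).card * q ^ (n - (∅ : Finset (Fin n)).card) else 0) = q ^ n := by
          rw [if_pos (by simp [SimpleGraph.isIndepSet_iff])]
          simp
        have e2 : (if G.IsIndepSet (↑L : Set (Fin n)) then p ^ L.card * q ^ (n - L.card) else 0)
            = p ^ 2 * q ^ (n - 2) := by rw [if_pos hL, hLc]
        have e3 : (if G.IsIndepSet (↑R : Set (Fin n)) then p ^ R.card * q ^ (n - R.card) else 0)
            = p ^ 2 * q ^ (n - 2) := by rw [if_pos hR, hRc]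
        have e4 : ∀ v : Fin n, (if G.IsIndepSet (↑({v} : Finset (Fin n)) : Set (Fin n)) then
            p ^ ({v} : Finset (Fin n)).card * q ^ (n - ({v} : Finset (Fin n)).card) else 0)
            = p * q ^ (n - 1) := by
          intro v
          rw [if_pos (by simp [SimpleGraph.isIndepSet_iff])]
          simp
        simp only [Function.Embedding.coeFn_mk, e1, e2, e3, e4, sum_const, card_univ,
          Fintype.card_fin, smul_eq_mul]
        ring
    _ ≤ _ := sum_le_sum_of_subset (subset_univ T)

/-! ## Two E3-shaped CNFs, one with repeated variables inside its clauses -/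

/-- YES witness: `(x₀ ∨ x₁ ∨ x₂) ∧ (x₃ ∨ x₄ ∨ x₅)` — a genuine E3-CNF; conflict graph `2K₃`.
[this work] -/
def φyes : CNF ℕ := [[(0, true), (1, true), (2, true)], [(3, true), (4, true), (5, true)]]

/-- NO witness: `(x₀ ∨ x₀ ∨ x₀) ∧ (¬x₀ ∨ ¬x₀ ∨ ¬x₀)` — clauses of LENGTH 3 whose variables repeat;
unsatisfiable, `val = 1/2`; conflict graph `K₃,₃` (equal literals inside a clause are NOT in
conflict, so each side is an independent triple). [this work] -/
def φno : CNF ℕ := [[(0, true), (0, true), (0, true)], [(0, false), (0, false), (0, false)]]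

/-- `φyes` has `6` literal occurrences. [this work] -/
theorem length_annot_φyes : (KarpClique.annot 0 φyes).length = 6 := rfl

/-- `φno` has `6` literal occurrences. [this work] -/
theorem length_annot_φno : (KarpClique.annot 0 φno).length = 6 := rfl

/-- Every clause of `φyes` has length `3`. [this work] -/
theorem φyes_width : ∀ c ∈ φyes, c.length = 3 := by decide

/-- Every clause of `φno` has length `3` (though only one variable). [this work] -/
theorem φno_width : ∀ c ∈ φno, c.length = 3 := by decide

/-- `φyes` is satisfiable (all-true). [this work] -/
theorem φyes_satisfiable : φyes.Satisfiable := ⟨fun _ => true, by decide⟩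

/-- `val(φno) ≤ 1/2`: every assignment satisfies exactly one of the two clauses. [this work] -/
theorem maxSatFraction_φno_le : φno.maxSatFraction ≤ 1 / 2 := by
  unfold CNF.maxSatFraction
  refine Finset.sup'_le _ _ fun τ _ => ?_
  generalize (fun x => if h : x ∈ CNF.vars φno then τ ⟨x, h⟩ else false) = σ
  cases h : σ 0 <;>
    simp [CNF.satisfiedFraction, CNF.numClauses, Clause.eval, Literal.eval, φno, h]

/-- In the conflict graph of `φyes` two distinct occurrences of the same clause are adjacent.
[this work] -/
theorem adj_φyes_of_sameClause : ∀ a b : Fin (KarpClique.annot 0 φyes).length, a ≠ b →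
    decide (a.val < 3) = decide (b.val < 3) → (conflictGraph φyes).Adj a b := by
  decide

/-- Degrees in the conflict graph of `φyes` are `≤ 2`. [this work] -/
theorem degree_φyes_le : ∀ v : Fin (KarpClique.annot 0 φyes).length,
    (univ.filter fun w => (conflictGraph φyes).Adj v w).card ≤ 2 := by
  decide

/-- Degrees in the conflict graph of `φno` are `≤ 3`. [this work] -/
theorem degree_φno_le : ∀ v : Fin (KarpClique.annot 0 φno).length,
    (univ.filter fun w => (conflictGraph φno).Adj v w).card ≤ 3 := by
  decide

/-- Hence no independent set of the conflict graph of `φyes` has three elements (pigeonhole on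
the two clauses). [this work] -/
theorem not_isIndepSet_φyes (I : Finset (Fin (KarpClique.annot 0 φyes).length)) (hI : 3 ≤ I.card) :
    ¬ (conflictGraph φyes).IsIndepSet (↑I : Set (Fin (KarpClique.annot 0 φyes).length)) := by
  intro hind
  have hc : (univ : Finset Bool).card < I.card := by
    rw [card_univ, Fintype.card_bool]; omega
  obtain ⟨a, ha, b, hb, hne, hab⟩ := exists_ne_map_eq_of_card_lt_of_maps_to hc
    (f := fun v : Fin (KarpClique.annot 0 φyes).length => decide (v.val < 3)) fun _ _ => mem_univ _
  exact hind (mem_coe.2 ha) (mem_coe.2 hb) hne (adj_φyes_of_sameClause a b hne hab)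

/-- The left pair `{0, 1}` of `K₃,₃` is independent in the conflict graph of `φno`. [this work] -/
theorem isIndepSet_φno_left : (conflictGraph φno).IsIndepSet
    ↑(univ.filter fun v : Fin (KarpClique.annot 0 φno).length => v.val < 2) := by
  decide

/-- The right pair `{3, 4}` of `K₃,₃` is independent in the conflict graph of `φno`. [this work] -/
theorem isIndepSet_φno_right : (conflictGraph φno).IsIndepSet
    ↑(univ.filter fun v : Fin (KarpClique.annot 0 φno).length => 3 ≤ v.val ∧ v.val < 5) := by
  decide

/-! ## The hard-core counts of the two codes -/

/-- UPPER BOUND for the YES code: only sets of size `≤ 2` can be independent in `2K₃`, so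
`N ≤ q⁶ + 6pq⁵ + 15p²q⁴`. [this work] -/
theorem hardcoreCount_φyes_le (Δ p q : ℕ) (hΔ : 3 ≤ Δ) :
    hardcoreCount Δ p q (encodingGraph.encode ⟨(KarpClique.annot 0 φyes).length, conflictGraph φyes⟩)
      ≤ q ^ 6 + 6 * (p * q ^ 5) + 15 * (p ^ 2 * q ^ 4) := by
  have hdeg := maxDegree_le_of_card_filter_le (conflictGraph φyes) 2 degree_φyes_le
    (Classical.decRel _)
  rw [hardcoreCount_encode_of_maxDegree_le Δ p q _ (hdeg.trans (by omega))]
  refine (sum_indep_le_of_no_triple (conflictGraph φyes) p q not_isIndepSet_φyes 6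
    length_annot_φyes).trans (le_of_eq ?_)
  simp [Finset.sum_range_succ, Nat.choose_two_right]

/-- LOWER BOUND for the NO code: `∅`, the six singletons and one pair inside each side of `K₃,₃`
are independent, so `N ≥ q⁶ + 6pq⁵ + 2p²q⁴`. [this work] -/
theorem le_hardcoreCount_φno (Δ p q : ℕ) (hΔ : 3 ≤ Δ) :
    q ^ 6 + 6 * (p * q ^ 5) + 2 * (p ^ 2 * q ^ 4) ≤
      hardcoreCount Δ p q (encodingGraph.encode ⟨(KarpClique.annot 0 φno).length, conflictGraph φno⟩) := by
  have hdeg := maxDegree_le_of_card_filter_le (conflictGraph φno) 3 degree_φno_le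
    (Classical.decRel _)
  rw [hardcoreCount_encode_of_maxDegree_le Δ p q _ (hdeg.trans hΔ)]
  have h := le_sum_indep_of_two_pairs (conflictGraph φno) p q _ _ isIndepSet_φno_left
    isIndepSet_φno_right (by decide) (by decide) (by decide) 6 length_annot_φno
  simpa using h

/-! ## The target `stub_conflictGraphGap` without `Nodup` is FALSE -/

/-- Stub S4b of the picked line with `φ.IsExactWidth 3` (every clause has 3 literals on 3 PAIRWISE
DISTINCT variables) weakened to "every clause has 3 literals" — variables may repeat inside a
clause. Verbatim otherwise. [this work] -/
def ConflictGraphGapWithoutNodup : Prop :=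
  ∀ (B : ℕ) (γ : ℚ), 0 < γ →
    ∃ (Δ p q : ℕ) (τ len : ℕ → ℕ), 3 ≤ Δ ∧ 0 < q ∧ hardCoreThreshold Δ < (p : ℝ) / q ∧ StrictMono len ∧
      ∀ φ : CNF ℕ, (∀ c ∈ φ, c.length = 3) → (∀ v : ℕ, (φ.countP fun cl => v ∈ cl.map Prod.fst) ≤ B) →
        0 < φ.length → ∀ x : List Bool,
        x = encodingGraph.encode ⟨(KarpClique.annot 0 φ).length,
          SimpleGraph.fromRel fun p q : Fin (KarpClique.annot 0 φ).length =>
            ((KarpClique.annot 0 φ)[p].1 = (KarpClique.annot 0 φ)[q].1 ∧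
                (KarpClique.annot 0 φ)[p].2.1 ≠ (KarpClique.annot 0 φ)[q].2.1) ∨
            ((KarpClique.annot 0 φ)[p].2.1 = (KarpClique.annot 0 φ)[q].2.1 ∧
                (KarpClique.annot 0 φ)[p].2.2 ≠ (KarpClique.annot 0 φ)[q].2.2)⟩ →
        x.length = len φ.length ∧
        (φ.Satisfiable → 8 * τ φ.length ≤ hardcoreCount Δ p q x) ∧
        (φ.maxSatFraction ≤ 1 - γ → 0 < hardcoreCount Δ p q x ∧ hardcoreCount Δ p q x ≤ τ φ.length)

/-- THE `Nodup` HALF OF `IsExactWidth 3` IS LOAD-BEARING FOR THE COUNTING WINDOW (target S4b).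
With repeated variables allowed inside a clause, `α(conflict graph) = m · val(φ)` fails: equal
literals of one clause are pairwise compatible. Witness at `B = 2`, `γ = 1/2`, `m = 2`:
`φno = (x ∨ x ∨ x) ∧ (¬x ∨ ¬x ∨ ¬x)` has `val = 1/2` but conflict graph `K₃,₃` with
`N ≥ q⁶ + 6pq⁵ + 2p²q⁴`, while the satisfiable `φyes = (x₀ ∨ x₁ ∨ x₂) ∧ (x₃ ∨ x₄ ∨ x₅)` has
conflict graph `2K₃` with `N ≤ q⁶ + 6pq⁵ + 15p²q⁴ < 8 (q⁶ + 6pq⁵ + 2p²q⁴)`; so no threshold `τ 2`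
separates `8 τ 2 ≤ N(yes)` from `N(no) ≤ τ 2`, whatever `(Δ, p, q)` with `q ≥ 1`. (The E3
rendering feeding S4b must therefore keep three DISTINCT variables per clause — which the tree's
`GapMachine.spec` / `gapE3SAT` do guarantee via `IsExactWidth`.) [this work] -/
theorem not_conflictGraphGapWithoutNodup : ¬ ConflictGraphGapWithoutNodup := by
  intro h
  obtain ⟨Δ, p, q, τ, len, hΔ, hq, -, -, hall⟩ := h 2 (1 / 2) (by norm_num)
  have hoccY : ∀ v : ℕ, (φyes.countP fun cl => v ∈ cl.map Prod.fst) ≤ 2 := fun v =>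
    List.countP_le_length.trans (le_of_eq rfl)
  have hoccN : ∀ v : ℕ, (φno.countP fun cl => v ∈ cl.map Prod.fst) ≤ 2 := fun v =>
    List.countP_le_length.trans (le_of_eq rfl)
  have hY : 8 * τ 2 ≤ hardcoreCount Δ p q
      (encodingGraph.encode ⟨(KarpClique.annot 0 φyes).length, conflictGraph φyes⟩) :=
    (hall φyes φyes_width hoccY (by decide) _ rfl).2.1 φyes_satisfiable
  have hN : hardcoreCount Δ p q
      (encodingGraph.encode ⟨(KarpClique.annot 0 φno).length, conflictGraph φno⟩) ≤ τ 2 :=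
    ((hall φno φno_width hoccN (by decide) _ rfl).2.2 (maxSatFraction_φno_le.trans (by norm_num))).2
  have hup := hardcoreCount_φyes_le Δ p q hΔ
  have hlow := le_hardcoreCount_φno Δ p q hΔ
  have hq6 : 0 < q ^ 6 := pow_pos hq 6
  omega

/-! ## The target `stub_dupPad` with `B` in place of `max B 1` is FALSE -/

/-- Stub S2b of the picked line with the occurrence bound of the output stated as `B` instead of
`max B 1`. Verbatim otherwise. [this work] -/
def DupPadWithPlainBound : Prop :=
  ∀ a : ℕ, ∃ (d : List Bool → List Bool) (m : ℕ → ℕ) (κ : ℚ), d ∈ FP ∧ StrictMono m ∧ (∀ k, 0 < m k) ∧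
    0 < κ ∧ ∀ (φ : CNF ℕ) (y : List Bool), φ.IsExactWidth 3 → φ.length ≤ (y.length + 2) ^ a →
      ∃ ψ : CNF ℕ, d (boolPair (encodingCNF.encode φ) y) = encodingCNF.encode ψ ∧ ψ.IsExactWidth 3 ∧
        ψ.length = m y.length ∧
        (∀ B : ℕ, (∀ v : ℕ, (φ.countP fun cl => v ∈ cl.map Prod.fst) ≤ B) →
          ∀ v : ℕ, (ψ.countP fun cl => v ∈ cl.map Prod.fst) ≤ B) ∧
        (φ.Satisfiable → ψ.Satisfiable) ∧
        (∀ γ : ℚ, φ.maxSatFraction ≤ 1 - γ → ψ.maxSatFraction ≤ 1 - κ * γ)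

/-- THE `max B 1` OF TARGET S2b IS NECESSARY: with a plain `B`, the empty input CNF (occurrence
bound `B = 0`) must be padded to `m |y| > 0` clauses of exact width 3, and the first variable of
the first padding clause occurs at least once. [this work] -/
theorem not_dupPadWithPlainBound : ¬ DupPadWithPlainBound := by
  intro h
  obtain ⟨d, m, κ, -, -, hmpos, -, hall⟩ := h 0
  obtain ⟨ψ, -, hψ3, hlen, hocc, -, -⟩ := hall [] [] (fun c hc => by simp at hc) (by simp)
  have hocc0 : ∀ v : ℕ, (ψ.countP fun cl => v ∈ cl.map Prod.fst) ≤ 0 := hocc 0 fun v => by simp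
  have hpos : 0 < ψ.length := by rw [hlen]; exact hmpos _
  obtain ⟨c, hc⟩ : ∃ c, c ∈ ψ := List.exists_mem_of_length_pos hpos
  have hc3 := (hψ3 c hc).1
  obtain ⟨l, hl⟩ : ∃ l, l ∈ c := List.exists_mem_of_length_pos (by omega)
  have hcount : 0 < ψ.countP fun cl => l.1 ∈ cl.map Prod.fst :=
    List.countP_pos_iff.2 ⟨c, hc, decide_eq_true (List.mem_map_of_mem hl)⟩
  have := hocc0 l.1
  omega

/-! ## Two harmless corners of the targets -/

/-- S2b's value clause at the empty input CNF is VACUOUS thanks to the tree's junk convention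
`val([]) = 1` (`CNF.maxSatFraction_nil`): the hypothesis `val [] ≤ 1 - γ` holds iff `γ ≤ 0`, and
then the conclusion `val ψ ≤ 1 - κγ` is automatic. (With the other common convention `val([]) = 0`
the stub `stub_dupPad` would be false: `[]` is satisfiable, so `ψ` would have to be satisfiable AND
of value `≤ 1 - κ`.) [this work] -/
theorem maxSatFraction_nil_le_iff (γ : ℚ) : CNF.maxSatFraction ([] : CNF ℕ) ≤ 1 - γ ↔ γ ≤ 0 := by
  rw [CNF.maxSatFraction_nil]
  constructor <;> intro h <;> linarith

/-- S4b's hypothesis `0 < φ.length` is NOT load-bearing: the conflict graph of `[]` is the empty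
graph on `Fin 0`, whose code has hard-core count `1` (the empty independent set), so at `m = 0` the
YES clause only forces `τ 0 = 0` and the NO clause is vacuous (`val [] = 1`). [this work] -/
theorem hardcoreCount_conflictGraph_nil (Δ p q : ℕ) :
    hardcoreCount Δ p q
      (encodingGraph.encode ⟨(KarpClique.annot 0 ([] : CNF ℕ)).length, conflictGraph []⟩) = 1 := by
  have h0 : (KarpClique.annot 0 ([] : CNF ℕ)).length = 0 := rfl
  have hdeg : ∀ inst : DecidableRel (conflictGraph ([] : CNF ℕ)).Adj,
      @SimpleGraph.maxDegree _ (conflictGraph []) _ inst ≤ Δ := fun inst =>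
    (@SimpleGraph.maxDegree_le_of_forall_degree_le _ (conflictGraph []) _ inst 0
      fun v => (Fin.cast h0 v).elim0).trans (Nat.zero_le _)
  rw [hardcoreCount_encode_of_maxDegree_le Δ p q _ (hdeg _)]
  have huniv : (univ : Finset (Finset (Fin (KarpClique.annot 0 ([] : CNF ℕ)).length))) = {∅} := by
    apply Finset.eq_singleton_iff_unique_mem.2
    refine ⟨mem_univ _, fun I _ => Finset.eq_empty_of_forall_notMem fun v _ => ?_⟩
    exact (Fin.cast h0 v).elim0
  rw [huniv, Finset.sum_singleton, if_pos (by simp [SimpleGraph.isIndepSet_iff])]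
  simp [h0]

end Summit.PneNP.PneNP.Theorems.PseudorandomTwinsAbove.Negative
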